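import Literature.Probability.Process.KrylovBogoliubov
import Literature.MathematicalPhysics.KineticTheory.FouriersLaw

/-!
# Finite-bias Clausius (stub `stub_finiteBiasClausius`), helper 2: Krylov–Bogoliubov–Cesàro from an initial law, with the Cesàro limit exposed

Helper file for crux `stmt-AtomisticToContinuum-9122` (`BondHeatUncertainty.LinearResponseFTUR`), line
`lebesgue-flip-duality`, stub `stub_finiteBiasClausius`. Theorems only. The tree's Krylov–Bogoliubov
theorems (`Literature.Probability.Process.KrylovBogoliubov(Cesaro)`, Da Prato–Zabczyk 1996, Thm 3.1.1 and
Cor. 3.1.2) start from a point mass and only assert the EXISTENCE of an invariant probability measure. The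
transient fluctuation theorem behind the finite-bias Clausius inequality needs the full content of
Thm 3.1.1 for a general initial law `ν`: the Cesàro averages `A_n = (n+1)⁻¹ ∫₀^{n+1} νP_s ds` of the
orbit of `ν` have a weakly convergent SUBSEQUENCE whose limit `μ` is invariant, obeys the Lyapunov moment
bounds, and — this is the point — `A_{φ k}(g) → μ(g)` for every bounded continuous `g`:

* `exists_invariant_tendsto_cesaro` — Markov kernels `κ : ℝ≥0 → Kernel X X` on a separable metrisable
  Borel space with Chapman–Kolmogorov, joint measurability and the Feller property; an initial probability
  measure `ν`; continuous `V i ≥ 0` with UNIFORM bounds `∫ V i d(κ s ∘ₘ ν) ≤ C i`, one of which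
  (`C i₀ < ∞`) has compact sublevel sets ⟹ an invariant probability measure `μ` with `∫ V i dμ ≤ C i`
  and a strictly increasing `φ : ℕ → ℕ` with
  `(φ k + 1)⁻¹ ∫₀^{φ k + 1} ∫ g d(κ s ∘ₘ ν) ds → ∫ g dμ` for all `g : X →ᵇ ℝ`;
* `pinnedChain_exists_invariant_tendsto_cesaro` — the same, specialised to the phase space of the
  oscillator chain (registered sub-goal of the stub; no new content).

The proof is the tree's (`exists_invariant_of_bounded_orbit`), verbatim up to the initial law: the orbit
`s ↦ κ (s⁺) ∘ₘ ν` is a Markov kernel from real time, the averages are `η ∘ₘ U_n` with `U_n` uniform on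
`(0, n+1]`, tight by Markov's inequality, Prokhorov gives the subsequence, the `2t‖g‖/(n+1)` defect
estimate and the Feller property give invariance, portmanteau gives the moment bounds.

Nothing here closes an item.
-/

noncomputable section

namespace Summit.AtomisticToContinuum.FouriersLaw.Theorems.LinearResponseFTUR

open MeasureTheory ProbabilityTheory Filter Topology Set
open scoped NNReal ENNReal BoundedContinuousFunction
open Literature.Probability.Process.MarkovSemigroup

variable {X : Type*} [MeasurableSpace X]

/-- Integrals of bounded observables against `κ ∘ₘ ν` are iterated integrals (Fubini for the
composition of a probability measure and a Markov kernel). -/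
theorem integral_comp_eq_integral_integral {Y : Type*} [MeasurableSpace Y] (κ : Kernel X Y)
    [IsMarkovKernel κ] (ν : Measure X) [IsProbabilityMeasure ν] {g : Y → ℝ}
    (hg : StronglyMeasurable g) {C : ℝ} (hC : ∀ x, ‖g x‖ ≤ C) :
    ∫ y, g y ∂(κ ∘ₘ ν) = ∫ x, ∫ y, g y ∂(κ x) ∂ν := by
  have hint : Integrable g (κ ∘ₘ ν) :=
    (integrable_const C).mono' hg.aestronglyMeasurable (Eventually.of_forall hC)
  rw [Measure.comp_eq_comp_const_apply] at hint ⊢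
  rw [Kernel.integral_comp hint, Kernel.const_apply]

/-- **Krylov–Bogoliubov–Cesàro from an initial law, with the Cesàro limit exposed** (Da Prato–Zabczyk
1996, Thm 3.1.1: "Assume that `P_t`, `t ≥ 0` is a Feller semigroup. If for some `ν ∈ M₁(E)` and some
sequence `T_n ↑ +∞`, `R*_{T_n} ν → μ` weakly as `n → ∞`, then `μ` is an invariant measure for `P_t`",
`R*_T ν = T⁻¹∫₀ᵀ P*_t ν dt`, together with Cor. 3.1.2 and Prokhorov's theorem). Let `(κ t)_{t ≥ 0}` be
Markov kernels on a separable metrisable Borel space with the Chapman–Kolmogorov law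
`κ (s + t) = κ t ∘ₖ κ s`, jointly measurable and Feller; `ν` an initial probability measure;
`V i ≥ 0` continuous with uniform orbit bounds `∫ V i d(κ s ∘ₘ ν) ≤ C i`, one of them (`C i₀ < ∞`) with
compact sublevel sets. Then there are an invariant probability measure `μ` with `∫ V i dμ ≤ C i` for all
`i` and a strictly increasing `φ : ℕ → ℕ` along which the Cesàro averages of the orbit of `ν` converge
weakly to `μ`: `(φ k + 1)⁻¹ ∫₀^{φ k + 1} (∫ g d(κ s ∘ₘ ν)) ds → ∫ g dμ` for every `g : X →ᵇ ℝ`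
(the proof of `Literature.Probability.Process.MarkovSemigroup.exists_invariant_of_bounded_orbit`, from `ν`). -/
theorem exists_invariant_tendsto_cesaro [TopologicalSpace X]
    [TopologicalSpace.MetrizableSpace X] [TopologicalSpace.SeparableSpace X] [BorelSpace X]
    (κ : ℝ≥0 → Kernel X X) [∀ t, IsMarkovKernel (κ t)]
    (h_add : ∀ s t : ℝ≥0, κ (s + t) = κ t ∘ₖ κ s)
    (h_meas : Measurable fun p : ℝ≥0 × X => κ p.1 p.2)
    (h_feller : ∀ (t : ℝ≥0) (g : X →ᵇ ℝ), Continuous fun x => ∫ y, g y ∂(κ t x))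
    (ν : Measure X) [IsProbabilityMeasure ν]
    {ι : Type*} (V : ι → X → ℝ≥0) (hV : ∀ i, Continuous (V i)) (C : ι → ℝ≥0∞)
    (hC : ∀ i (s : ℝ≥0), ∫⁻ y, V i y ∂(κ s ∘ₘ ν) ≤ C i)
    (i₀ : ι) (hi₀ : C i₀ ≠ ∞) (hcpt : ∀ R : ℝ≥0, IsCompact {x | V i₀ x ≤ R}) :
    ∃ μ : Measure X, IsProbabilityMeasure μ ∧ (∀ t, Kernel.Invariant (κ t) μ) ∧
      (∀ i, ∫⁻ x, V i x ∂μ ≤ C i) ∧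
      ∃ φ : ℕ → ℕ, StrictMono φ ∧ ∀ g : X →ᵇ ℝ,
        Tendsto (fun k => ((φ k : ℝ) + 1)⁻¹ *
            ∫ s in (0:ℝ)..((φ k : ℝ) + 1), ∫ y, g y ∂(κ s.toNNReal ∘ₘ ν))
          atTop (𝓝 (∫ x, g x ∂μ)) := by
  -- the orbit of `ν`, as a Markov kernel from real time (`s ↦ κ (s⁺) ∘ₘ ν`)
  have hK : Measurable fun p : ℝ × X => κ p.1.toNNReal p.2 :=
    h_meas.comp ((measurable_real_toNNReal.comp measurable_fst).prodMk measurable_snd)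
  have hηm : Measurable fun s : ℝ => κ s.toNNReal ∘ₘ ν := by
    refine Measure.measurable_of_measurable_coe _ fun A hA => ?_
    have h : (fun s : ℝ => (κ s.toNNReal ∘ₘ ν) A) = fun s => ∫⁻ x, κ s.toNNReal x A ∂ν := by
      funext s
      exact Measure.bind_apply hA (Kernel.aemeasurable _)
    rw [h]
    exact ((Measure.measurable_coe hA).comp hK).lintegral_prod_right'
  let η : Kernel ℝ X := ⟨fun s => κ s.toNNReal ∘ₘ ν, hηm⟩
  haveI : IsMarkovKernel η :=
    ⟨fun s => by change IsProbabilityMeasure (κ s.toNNReal ∘ₘ ν); infer_instance⟩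
  have hη : ∀ s, η s = κ s.toNNReal ∘ₘ ν := fun s => rfl
  -- uniform laws on `(0, n+1]` and the Cesàro averages `A n`
  have hn0 : ∀ n : ℕ, ((n : ℝ≥0∞) + 1) ≠ 0 := fun n => by positivity
  have hntop : ∀ n : ℕ, ((n : ℝ≥0∞) + 1) ≠ ∞ := fun n => by simp
  let U : ℕ → Measure ℝ := fun n => ((n : ℝ≥0∞) + 1)⁻¹ • volume.restrict (Ioc (0:ℝ) (n + 1))
  haveI hU : ∀ n, IsProbabilityMeasure (U n) := fun n => by
    constructor
    change (((n : ℝ≥0∞) + 1)⁻¹ • volume.restrict (Ioc (0:ℝ) (n + 1))) univ = 1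
    rw [Measure.smul_apply, Measure.restrict_apply_univ, Real.volume_Ioc, smul_eq_mul]
    have : ENNReal.ofReal ((n:ℝ) + 1 - 0) = (n : ℝ≥0∞) + 1 := by
      rw [sub_zero]; norm_cast
    rw [this]
    exact ENNReal.inv_mul_cancel (hn0 n) (hntop n)
  let A : ℕ → Measure X := fun n => η ∘ₘ U n
  haveI hA : ∀ n, IsProbabilityMeasure (A n) := fun n => by
    change IsProbabilityMeasure (η ∘ₘ U n); infer_instance
  -- moment bounds along the averages
  have hAV : ∀ i n, ∫⁻ x, V i x ∂(A n) ≤ C i := fun i n =>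
    lintegral_comp_measure_le η (U n) (hV i).measurable.coe_nnreal_ennreal fun s => hC i _
  -- tightness (Markov + compact sublevel sets of `V i₀`) and Prokhorov
  let P : ℕ → ProbabilityMeasure X := fun n => ⟨A n, hA n⟩
  have htight : IsTightMeasureSet
      {x | ∃ μ ∈ Set.range P, ((μ : ProbabilityMeasure X) : Measure X) = x} := by
    refine isTightMeasureSet_of_lintegral_le (hV i₀) hcpt hi₀ ?_
    rintro _ ⟨μ, ⟨n, rfl⟩, rfl⟩
    exact hAV i₀ n
  obtain ⟨μ, -, φ, hφ, hlim⟩ := (isCompact_closure_of_isTightMeasureSet htight).tendsto_subseq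
    (fun n => subset_closure (Set.mem_range_self n))
  have hPφ : ∀ k, ((P (φ k) : ProbabilityMeasure X) : Measure X) = A (φ k) := fun k => rfl
  -- Cesàro integrals of bounded observables
  have hces : ∀ (n : ℕ) {f : X → ℝ} (_ : StronglyMeasurable f) {B : ℝ} (_ : ∀ x, ‖f x‖ ≤ B),
      ∫ x, f x ∂(A n) = ((n : ℝ) + 1)⁻¹ * ∫ s in (0:ℝ)..(n + 1), ∫ y, f y ∂(η s) := by
    intro n f hf B hfb
    change ∫ x, f x ∂(η ∘ₘ U n) = _
    rw [integral_comp_measure_eq η (U n) hf hfb]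
    change ∫ s, ∫ y, f y ∂(η s) ∂(((n : ℝ≥0∞) + 1)⁻¹ • volume.restrict (Ioc (0:ℝ) (n + 1))) = _
    rw [integral_smul_measure, intervalIntegral.integral_of_le (by positivity), smul_eq_mul]
    congr 1
    rw [ENNReal.toReal_inv]
    norm_cast
  -- weak limits of bounded continuous observables along the subsequence
  have hB : ∀ g : X →ᵇ ℝ, Tendsto (fun k => ∫ x, g x ∂(A (φ k))) atTop (𝓝 (∫ x, g x ∂(μ : Measure X))) :=
    fun g => (ProbabilityMeasure.tendsto_iff_forall_integral_tendsto.1 hlim) g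
  refine ⟨μ, inferInstance, fun t => ?_, fun i => ?_, φ, hφ, fun g => ?_⟩
  · /- invariance under `κ t`: test against bounded continuous `g`; `P_t g` is bounded
    continuous (Feller) and the Cesàro averages are asymptotically invariant. -/
    apply ext_of_forall_integral_eq_of_IsFiniteMeasure
    intro g
    have hg_bd : ∀ y, ‖g y‖ ≤ ‖g‖ := fun y => g.norm_coe_le_norm y
    have hPg_bd : ∀ (s : ℝ≥0) (x : X), ‖∫ y, g y ∂(κ s x)‖ ≤ ‖g‖ := fun s x => by
      calc ‖∫ y, g y ∂(κ s x)‖ ≤ ‖g‖ * (κ s x).real univ :=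
            norm_integral_le_of_norm_le_const (Eventually.of_forall hg_bd)
        _ = ‖g‖ := by simp
    let Pg : X →ᵇ ℝ := BoundedContinuousFunction.ofNormedAddCommGroup
      (fun x => ∫ y, g y ∂(κ t x)) (h_feller t g) ‖g‖ (hPg_bd t)
    have hPg : ∀ x, Pg x = ∫ y, g y ∂(κ t x) := fun x => rfl
    -- the left-hand side is `∫ P_t g dμ`
    have hlhs : ∫ x, g x ∂((μ : Measure X).bind (κ t)) = ∫ x, Pg x ∂(μ : Measure X) :=
      integral_comp_eq_integral_integral (κ t) (μ : Measure X) g.continuous.stronglyMeasurable hg_bd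
    rw [hlhs]
    have hA' := hB Pg
    have hB' := hB g
    -- the orbit observable `G s = ∫ g d(κ_{s⁺} ∘ₘ ν)`
    set G : ℝ → ℝ := fun s => ∫ y, g y ∂(η s) with hG_def
    have hG_meas : StronglyMeasurable G :=
      g.continuous.stronglyMeasurable.integral_kernel (κ := η)
    have hG_bd : ∀ s, ‖G s‖ ≤ ‖g‖ := fun s => by
      calc ‖∫ y, g y ∂(η s)‖ ≤ ‖g‖ * (η s).real univ :=
            norm_integral_le_of_norm_le_const (Eventually.of_forall hg_bd)
        _ = ‖g‖ := by simp
    have hGint : ∀ a b : ℝ, IntervalIntegrable G volume a b := fun a b =>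
      (intervalIntegrable_const (c := ‖g‖)).mono_fun' hG_meas.aestronglyMeasurable
        (Eventually.of_forall fun s => hG_bd s)
    have h1 : ∀ n : ℕ, ∫ x, g x ∂(A n) = ((n : ℝ) + 1)⁻¹ * ∫ s in (0:ℝ)..(n + 1), G s :=
      fun n => hces n g.continuous.stronglyMeasurable hg_bd
    have hshift : ∀ s : ℝ, 0 ≤ s → ∫ y, Pg y ∂(η s) = G (s + t) := by
      intro s hs
      simp only [hG_def, hη]
      rw [integral_comp_eq_integral_integral (κ s.toNNReal) ν Pg.continuous.stronglyMeasurable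
          (fun x => hPg_bd t x),
        integral_comp_eq_integral_integral (κ (s + t).toNNReal) ν g.continuous.stronglyMeasurable hg_bd]
      refine integral_congr_ae (Eventually.of_forall fun x => ?_)
      simp only [hPg]
      rw [integral_integral_eq_of_add κ h_add _ _ x g.continuous.stronglyMeasurable hg_bd]
      have hst : (s + (t : ℝ)).toNNReal = s.toNNReal + t := by
        apply NNReal.eq
        rw [NNReal.coe_add, Real.coe_toNNReal _ (add_nonneg hs t.coe_nonneg),
          Real.coe_toNNReal _ hs]
      rw [hst]
    have h2 : ∀ n : ℕ, ∫ x, Pg x ∂(A n) =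
        ((n : ℝ) + 1)⁻¹ * ∫ s in (t : ℝ)..(n + 1 + t), G s := by
      intro n
      rw [hces n Pg.continuous.stronglyMeasurable (fun x => hPg_bd t x)]
      congr 1
      have hc : ∫ s in (0:ℝ)..(n + 1), ∫ y, Pg y ∂(η s) = ∫ s in (0:ℝ)..(n + 1), G (s + t) := by
        refine intervalIntegral.integral_congr fun s hs => hshift s ?_
        rw [uIcc_of_le (by positivity)] at hs
        exact hs.1
      rw [hc, intervalIntegral.integral_comp_add_right, zero_add]
    -- the defect is `O(1/n)`
    have hD : Tendsto (fun n => ∫ x, Pg x ∂(A n) - ∫ x, g x ∂(A n)) atTop (𝓝 0) := by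
      have hbound : ∀ n : ℕ, ‖∫ x, Pg x ∂(A n) - ∫ x, g x ∂(A n)‖ ≤
          2 * ‖g‖ * t / ((n : ℝ) + 1) := by
        intro n
        rw [h1 n, h2 n, ← mul_sub]
        have hTt : (∫ s in (t:ℝ)..(n + 1 + t), G s) - ∫ s in (0:ℝ)..(n + 1), G s =
            (∫ s in ((n:ℝ) + 1)..(n + 1 + t), G s) - ∫ s in (0:ℝ)..t, G s := by
          have e1 := intervalIntegral.integral_add_adjacent_intervals (hGint 0 t)
            (hGint t (n + 1 + t))
          have e2 := intervalIntegral.integral_add_adjacent_intervals (hGint 0 (n + 1))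
            (hGint (n + 1) (n + 1 + t))
          linarith
        rw [hTt, norm_mul, norm_inv, Real.norm_of_nonneg (by positivity)]
        have b1 : ‖∫ s in ((n:ℝ) + 1)..(n + 1 + t), G s‖ ≤ ‖g‖ * t := by
          have := intervalIntegral.norm_integral_le_of_norm_le_const (a := (n:ℝ) + 1)
            (b := n + 1 + t) (C := ‖g‖) (f := G) fun s _ => hG_bd s
          simpa using this
        have b2 : ‖∫ s in (0:ℝ)..t, G s‖ ≤ ‖g‖ * t := by
          have := intervalIntegral.norm_integral_le_of_norm_le_const (a := (0:ℝ))
            (b := t) (C := ‖g‖) (f := G) fun s _ => hG_bd s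
          simpa using this
        calc ((n:ℝ) + 1)⁻¹ * ‖(∫ s in ((n:ℝ) + 1)..(n + 1 + t), G s) - ∫ s in (0:ℝ)..t, G s‖
            ≤ ((n:ℝ) + 1)⁻¹ * (‖g‖ * t + ‖g‖ * t) := by
              gcongr
              exact (norm_sub_le _ _).trans (add_le_add b1 b2)
          _ = 2 * ‖g‖ * t / ((n : ℝ) + 1) := by ring
      refine squeeze_zero_norm hbound ?_
      have h := (tendsto_const_div_atTop_nhds_zero_nat (2 * ‖g‖ * t)).comp (tendsto_add_atTop_nat 1)
      refine h.congr fun n => ?_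
      simp
    have hD' : Tendsto (fun k => ∫ x, Pg x ∂(A (φ k)) - ∫ x, g x ∂(A (φ k))) atTop (𝓝 0) :=
      hD.comp hφ.tendsto_atTop
    have := tendsto_nhds_unique (hA'.sub hB') hD'
    linarith
  · -- the moment bound passes to the limit (portmanteau for open superlevel sets)
    have hopen : ∀ G, IsOpen G → (μ : Measure X) G ≤
        atTop.liminf (fun k => ((P (φ k) : ProbabilityMeasure X) : Measure X) G) :=
      fun G hG => ProbabilityMeasure.le_liminf_measure_open_of_tendsto hlim hG
    have h1 := lintegral_le_liminf_lintegral_of_forall_isOpen_measure_le_liminf_measure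
      (μ := (μ : Measure X)) (μs := fun k => ((P (φ k) : ProbabilityMeasure X) : Measure X))
      (f := fun x => (V i x : ℝ)) (NNReal.continuous_coe.comp (hV i)) (fun x => (V i x).coe_nonneg)
      hopen
    simp only [ENNReal.ofReal_coe_nnreal] at h1
    refine h1.trans (liminf_le_of_frequently_le' (Frequently.of_forall fun k => ?_))
    rw [hPφ]
    exact hAV i (φ k)
  · -- the Cesàro limit along the subsequence
    have hg_bd : ∀ y, ‖g y‖ ≤ ‖g‖ := fun y => g.norm_coe_le_norm y
    have h1 : ∀ n : ℕ, ∫ x, g x ∂(A n) =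
        ((n : ℝ) + 1)⁻¹ * ∫ s in (0:ℝ)..(n + 1), ∫ y, g y ∂(κ s.toNNReal ∘ₘ ν) :=
      fun n => hces n g.continuous.stronglyMeasurable hg_bd
    refine (hB g).congr fun k => ?_
    rw [h1 (φ k)]

open Literature.MathematicalPhysics.KineticTheory.HeatConduction in
/-- **Krylov–Bogoliubov–Cesàro from an initial law on the phase space of the oscillator chain**
(registered sub-goal of `stub_finiteBiasClausius`; `exists_invariant_tendsto_cesaro` with one Lyapunov
observable `V` with compact sublevel sets and a uniform orbit bound `∫ V d(κ s ∘ₘ ν) ≤ C < ∞`): an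
invariant probability measure `μ` with `∫ V dμ ≤ C` and a subsequence along which the Cesàro averages
of the orbit of `ν` converge weakly to `μ` (Da Prato–Zabczyk 1996, Thm 3.1.1 and Cor. 3.1.2). -/
theorem pinnedChain_exists_invariant_tendsto_cesaro :
    ∀ (N : ℕ) (κ : ℝ≥0 → Kernel (PhaseSpace N) (PhaseSpace N)) [∀ t, IsMarkovKernel (κ t)],
    (∀ s t : ℝ≥0, κ (s + t) = (κ t).comp (κ s)) →
    (Measurable fun p : ℝ≥0 × PhaseSpace N => κ p.1 p.2) →
    (∀ (t : ℝ≥0) (g : BoundedContinuousFunction (PhaseSpace N) ℝ),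
      Continuous fun x => ∫ y, g y ∂(κ t x)) →
    ∀ (ν : Measure (PhaseSpace N)) [IsProbabilityMeasure ν] (V : PhaseSpace N → ℝ≥0),
      Continuous V → (∀ R : ℝ≥0, IsCompact {x | V x ≤ R}) →
    ∀ C : ℝ≥0∞, C ≠ ⊤ → (∀ s : ℝ≥0, ∫⁻ y, V y ∂(ν.bind (κ s)) ≤ C) →
    ∃ μ : Measure (PhaseSpace N), IsProbabilityMeasure μ ∧ (∀ t, Kernel.Invariant (κ t) μ) ∧
      ∫⁻ x, V x ∂μ ≤ C ∧
      ∃ φ : ℕ → ℕ, StrictMono φ ∧ ∀ g : BoundedContinuousFunction (PhaseSpace N) ℝ,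
        Tendsto (fun k => ((φ k : ℝ) + 1)⁻¹ *
            ∫ s in (0:ℝ)..((φ k : ℝ) + 1), ∫ y, g y ∂(ν.bind (κ s.toNNReal)))
          atTop (𝓝 (∫ x, g x ∂μ)) := by
  intro N κ _ h_add h_meas h_feller ν _ V hV hcpt C hC hbound
  obtain ⟨μ, hμ, hinv, hmom, φ, hφ, hlim⟩ := exists_invariant_tendsto_cesaro κ h_add h_meas h_feller ν
    (fun _ : Unit => V) (fun _ => hV) (fun _ => C) (fun _ s => hbound s) () hC hcpt
  exact ⟨μ, hμ, hinv, hmom (), φ, hφ, hlim⟩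

end Summit.AtomisticToContinuum.FouriersLaw.Theorems.LinearResponseFTUR

end
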